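import Summits.ResolutionOfSingularities.ResolutionOfSingularities.Theorems.FrobeniusClosingSteerBetaGlueSupport
import Summits.ResolutionOfSingularities.ResolutionOfSingularities.Theorems.FrobeniusClosingSteerBetaNewtonTransportX
import HarnessLib

/-!
# Crux `Steer` (stmt-ResolutionOfSingularities-16345), chain W4.1, β-LEAF, K-β2♭ part (III), file X1: support for the GLUE
# `xLetterLawHat_of` — the near-point region of the `x`-chart origin, GENERAL weight filtrations, purification over an arbitrary
# up-closed region, and the twisted `δ*` along the orbit (def-free)

OURS (campaign `res-hironaka`, rung L ★L-G4, slot W4.1; statements about the route's own objects; they replace the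
role of no printed item and are NOT statements of the manuscript under review [claim: Hironaka2017, status:
under-review]; AI review is weaker than expert review). Seat res-D-pv-003 (gen 7), K-β2♭ owner; GLUE (III) per
res-L0-w41-plan-1 RULING 276(a).

* `forall_minExponents_nearX` / `strictTransform_mem_pow_of_nearX` — along the `x`-chart letter at the origin, `f₁ ∈ 𝔪₁^d` iff every
  minimal exponent of `f` has `e₀ + 2e₁ + 2e₂ + 2e₃ ≥ 2d` (the point `(A, B)` has `A + 2B ≥ 2`).
* `wIdeal_mul_le`, `pow_mem_wIdeal`, `span_uPow_wIdeal_le_of_frame` — the weight filtration `(t^e : n ≤ Σ ωₗ eₗ)` for an ARBITRARY weight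
  vector `ω` is multiplicative and stable under frame changes respecting the weights.
* `exists_purified_region` — PURIFICATION relative to an arbitrary up-closed exponent region `R` and an arbitrary «good» monomial ideal.
* `deltaStarGeTw_iff_of_isGaugeRepTw`, `isDeltaStarTw_iff_of_isGaugeRepTw`, `isDeltaStarTw_unique` — the twisted `δ*` along the orbit.

[cite: CossartPiltant2019, Prop. 2.1 and 2.6] [cite: CossartJannsenSaito2020, Lemma 12.1] No Theses file is imported; nothing here is a
route item or a registration.
-/

noncomputable section

-- `Summit.<S>.<S>.…` duplicates the summit name by design (single-problem summit).
set_option linter.dupNamespace false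

namespace Summit.ResolutionOfSingularities.ResolutionOfSingularities.Theorems.SwitchingDichotomy.BetaNewton

open IsLocalRing
open Literature.AlgebraicGeometry.Resolution
open Literature.AlgebraicGeometry.Resolution.CossartPiltant (uPow uPow_mem_span_uPow uPow_mem_span_uPow_of_le minExponents
  uPow_add uPow_single exists_expansion_minExponents coeff_not_mem_of_minimal)
open Summit.ResolutionOfSingularities.ResolutionOfSingularities.Theorems.SwitchingDichotomy.BetaPolygon
open Summit.ResolutionOfSingularities.ResolutionOfSingularities.Theorems.SwitchingDichotomy.BetaLetter (uPow_four range_four)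

variable {S S₁ : Type} [CommRing S] [CommRing S₁]

/-! ## §1 The near-point region of the `x`-chart origin -/

/-- **`f₁ ∈ 𝔪₁^d` forces the near-point region of the `x`-chart origin**: every minimal exponent of `f` has
`e₀ + 2e₁ + 2e₂ + 2e₃ ≥ 2d`. [cite: CossartPiltant2019, Prop. 2.6] -/
theorem forall_minExponents_nearX [IsLocalRing S] [IsLocalRing S₁] (φ : S →+* S₁) {x y z w : S} {v₁ z₁ w₁ : S₁}
    (ht : IsRsopPart ![x, y, z, w]) (ht' : IsRsopPart ![φ x, v₁, z₁, w₁])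
    (hspan : Ideal.span {x, y, z, w} = maximalIdeal S) (hspan₁ : Ideal.span {φ x, v₁, z₁, w₁} = maximalIdeal S₁)
    (hy : φ y = φ x * v₁) (hz : φ z = φ x * z₁) (hw : φ w = φ x * w₁) {d : ℕ} {f : S} {g : S₁}
    (hfd : f ∈ maximalIdeal S ^ d) (hg : g * φ x ^ d = φ f) (hgd : g ∈ maximalIdeal S₁ ^ d) :
    ∀ a ∈ minExponents ![x, y, z, w] f, 2 * d ≤ a 0 + 2 * a 1 + 2 * a 2 + 2 * a 3 := by
  intro a ha
  obtain ⟨-, h2⟩ := minExponents_strictTransformX φ ht ht' hspan hspan₁ hy hz hw hfd hg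
  obtain ⟨a', ha', hle⟩ := h2 a ha
  have hdeg' := (mem_pow_iff_forall_minExponents ht' hspan₁ d g).mp hgd a' ha'
  have hdeg := (mem_pow_iff_forall_minExponents ht hspan d f).mp hfd a ha
  rw [sum_four] at hdeg' hdeg
  obtain ⟨k0, k1, k2, k3⟩ := (le_transportX_iff a a' d).mp hle
  omega

/-- **The near-point region forces `f₁ ∈ 𝔪₁^d`** along the `x`-chart letter. [cite: CossartPiltant2019, Prop. 2.6] -/
theorem strictTransform_mem_pow_of_nearX [IsLocalRing S] [IsLocalRing S₁] (φ : S →+* S₁) {x y z w : S} {v₁ z₁ w₁ : S₁}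
    (ht : IsRsopPart ![x, y, z, w]) (ht' : IsRsopPart ![φ x, v₁, z₁, w₁])
    (hspan : Ideal.span {x, y, z, w} = maximalIdeal S) (hspan₁ : Ideal.span {φ x, v₁, z₁, w₁} = maximalIdeal S₁)
    (hy : φ y = φ x * v₁) (hz : φ z = φ x * z₁) (hw : φ w = φ x * w₁) {d : ℕ} {f : S} {g : S₁}
    (hfd : f ∈ maximalIdeal S ^ d) (hg : g * φ x ^ d = φ f)
    (hnear : ∀ a ∈ minExponents ![x, y, z, w] f, 2 * d ≤ a 0 + 2 * a 1 + 2 * a 2 + 2 * a 3) :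
    g ∈ maximalIdeal S₁ ^ d := by
  obtain ⟨h1, -⟩ := minExponents_strictTransformX φ ht ht' hspan hspan₁ hy hz hw hfd hg
  refine (mem_pow_iff_forall_minExponents ht' hspan₁ d g).mpr fun a' ha' => ?_
  obtain ⟨a, ha, rfl⟩ := h1 a' ha'
  have hdeg := (mem_pow_iff_forall_minExponents ht hspan d f).mp hfd a ha
  rw [sum_four] at hdeg
  rw [sum_transportX]
  have := hnear a ha
  omega

/-! ## §2 General weight filtrations `F_n = (t^e : n ≤ Σ ωₗ eₗ)` -/

/-- Weight ideals are multiplicative. [folklore] -/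
theorem wIdeal_mul_le (t : Fin 4 → S) (ω : Fin 4 → ℕ) (a b : ℕ) :
    Ideal.span (uPow t '' {e | a ≤ ∑ l, ω l * e l}) * Ideal.span (uPow t '' {e | b ≤ ∑ l, ω l * e l}) ≤
      Ideal.span (uPow t '' {e | a + b ≤ ∑ l, ω l * e l}) := by
  rw [Ideal.span_mul_span', Ideal.span_le]
  rintro _ ⟨_, ⟨e, he, rfl⟩, _, ⟨e', he', rfl⟩, rfl⟩
  simp only [Set.mem_setOf_eq] at he he'
  show uPow t e * uPow t e' ∈ _
  rw [← uPow_add]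
  refine uPow_mem_span_uPow t ?_
  simp only [Set.mem_setOf_eq, Pi.add_apply, mul_add, Finset.sum_add_distrib]
  omega

/-- Weight ideals decrease. [folklore] -/
theorem wIdeal_anti (t : Fin 4 → S) (ω : Fin 4 → ℕ) {a b : ℕ} (h : a ≤ b) :
    Ideal.span (uPow t '' {e | b ≤ ∑ l, ω l * e l}) ≤ Ideal.span (uPow t '' {e | a ≤ ∑ l, ω l * e l}) :=
  Ideal.span_mono (Set.image_mono fun _ (he : b ≤ _) => le_trans h he)

/-- Powers climb a weight filtration. [folklore] -/
theorem pow_mem_wIdeal (t : Fin 4 → S) (ω : Fin 4 → ℕ) {a : ℕ} {s : S}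
    (hs : s ∈ Ideal.span (uPow t '' {e | a ≤ ∑ l, ω l * e l})) (n : ℕ) :
    s ^ n ∈ Ideal.span (uPow t '' {e | n * a ≤ ∑ l, ω l * e l}) := by
  induction n with
  | zero =>
    rw [pow_zero, zero_mul]
    have : (1 : S) = uPow t 0 := by simp [uPow]
    rw [this]; exact uPow_mem_span_uPow t (by simp)
  | succ n ih =>
    rw [pow_succ, Nat.succ_mul]
    exact wIdeal_mul_le t ω _ _ (Ideal.mul_mem_mul ih hs)

/-- **Base change of a weight filtration**: if each old parameter `tₗ` lies in `F_(ωₗ)(t′)`, then `F_n(t) ≤ F_n(t′)`. [folklore] -/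
theorem span_uPow_wIdeal_le_of_frame (t t' : Fin 4 → S) (ω : Fin 4 → ℕ)
    (h : ∀ l, t l ∈ Ideal.span (uPow t' '' {e | ω l ≤ ∑ l, ω l * e l})) (n : ℕ) :
    Ideal.span (uPow t '' {e | n ≤ ∑ l, ω l * e l}) ≤ Ideal.span (uPow t' '' {e | n ≤ ∑ l, ω l * e l}) := by
  rw [Ideal.span_le]
  rintro _ ⟨e, he, rfl⟩
  simp only [Set.mem_setOf_eq] at he
  rw [SetLike.mem_coe]
  have hprod : uPow t e = ∏ l, t l ^ e l := rfl
  have h0 := pow_mem_wIdeal t' ω (h 0) (e 0)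
  have h1 := pow_mem_wIdeal t' ω (h 1) (e 1)
  have h2 := pow_mem_wIdeal t' ω (h 2) (e 2)
  have h3 := pow_mem_wIdeal t' ω (h 3) (e 3)
  have h01 := wIdeal_mul_le t' ω _ _ (Ideal.mul_mem_mul h0 h1)
  have h012 := wIdeal_mul_le t' ω _ _ (Ideal.mul_mem_mul h01 h2)
  have h0123 := wIdeal_mul_le t' ω _ _ (Ideal.mul_mem_mul h012 h3)
  rw [hprod, Fin.prod_univ_four]
  refine wIdeal_anti t' ω ?_ h0123
  rw [sum_four] at he
  nlinarith [he]

/-- A parameter of the new frame lies in the weight ideal of its own weight. [folklore] -/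
theorem param_mem_wIdeal (t' : Fin 4 → S) (ω : Fin 4 → ℕ) (l : Fin 4) :
    t' l ∈ Ideal.span (uPow t' '' {e | ω l ≤ ∑ l, ω l * e l}) := by
  rw [← uPow_single t' l]
  refine uPow_mem_span_uPow _ ?_
  simp only [Set.mem_setOf_eq]
  rw [Finset.sum_eq_single l (fun b _ hb => by simp [Pi.single_eq_of_ne hb]) (by simp)]
  simp

/-- The maximal ideal lies in `F_m(t′)` when every weight is `≥ m`. [folklore] -/
theorem maximalIdeal_le_wIdeal [IsLocalRing S] {x y z' w' : S} (hspan' : Ideal.span {x, y, z', w'} = maximalIdeal S)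
    (ω : Fin 4 → ℕ) {m : ℕ} (hm : ∀ l, m ≤ ω l) :
    maximalIdeal S ≤ Ideal.span (uPow ![x, y, z', w'] '' {e | m ≤ ∑ l, ω l * e l}) := by
  rw [← hspan', ← range_four, Ideal.span_le]
  rintro _ ⟨l, rfl⟩
  exact wIdeal_anti _ ω (hm l) (param_mem_wIdeal _ ω l)

/-! ## §3 Purification over an arbitrary up-closed region -/

/-- **PURIFICATION, general form.** `t` part of a regular system of parameters, characteristic `2`; `Good` a monomial ideal given by an
UP-CLOSED exponent set `G`, `R` an UP-CLOSED exponent region. If `f ∈ (t^e : e ∈ G)` and the cleaning `f + t^ε q²` lies in `(t^e : e ∈ R)`, then some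
cleaning `f + t^ε q′²` lies in BOTH, and `f + t^ε q′² = (f + t^ε q²) + t^ε r²`. [cite: CossartPiltant2019, Prop. 2.1] -/
theorem exists_purified_region [IsLocalRing S] [CharP S 2] {n : ℕ} {t : Fin n → S} (ht : IsRsopPart t)
    {G R : Set (Fin n → ℕ)} (hG : ∀ b a, b ≤ a → b ∈ G → a ∈ G) (hR : ∀ b a, b ≤ a → b ∈ R → a ∈ R) {f q : S}
    (ε : Fin n → ℕ)
    (hfG : f ∈ Ideal.span (uPow t '' G)) (hB : f + uPow t ε * q ^ 2 ∈ Ideal.span (uPow t '' R)) :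
    ∃ q' r : S, f + uPow t ε * q' ^ 2 ∈ Ideal.span (uPow t '' G) ∧ f + uPow t ε * q' ^ 2 ∈ Ideal.span (uPow t '' R) ∧
      f + uPow t ε * q' ^ 2 = (f + uPow t ε * q ^ 2) + uPow t ε * r ^ 2 := by
  classical
  haveI := ht.isRegularLocalRing
  have h2 : (2 : S) = 0 := by simpa using CharP.cast_eq_zero S 2
  obtain ⟨hQ, hqQ, hminQ⟩ := ht.minExponents_spec q
  obtain ⟨η, hηq⟩ := exists_expansion_minExponents t hqQ
  have hηu := coeff_not_mem_of_minimal _ hQ hminQ hηq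
  set Q := minExponents t q with hQdef
  set P : (Fin n → ℕ) → Prop := fun c => 2 • c + ε ∈ G with hP
  set QG := Q.filter (fun c => P c) with hQG
  set QR := Q.filter (fun c => ¬ P c) with hQR
  set q' : S := ∑ c ∈ QG, η c * uPow t c with hq'
  set r : S := ∑ c ∈ QR, η c * uPow t c with hr
  have hsplit : q = q' + r := by rw [hηq, hq', hr, ← Finset.sum_filter_add_sum_filter_not Q P]
  have hsq : uPow t ε * q' ^ 2 = uPow t ε * q ^ 2 + uPow t ε * r ^ 2 := by
    rw [hsplit, add_sq]
    linear_combination (-(uPow t ε * q' * r) - uPow t ε * r ^ 2) * h2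
  have hsqG : uPow t ε * q' ^ 2 = ∑ c ∈ QG, η c ^ 2 * uPow t (2 • c + ε) := by
    have h := mul_sq_expansion t QG η id ε
    simp only [id] at h
    rw [hq', h]
  have hsqR : uPow t ε * r ^ 2 = ∑ c ∈ QR, η c ^ 2 * uPow t (2 • c + ε) := by
    have h := mul_sq_expansion t QR η id ε
    simp only [id] at h
    rw [hr, h]
  have hmemG : f + uPow t ε * q' ^ 2 ∈ Ideal.span (uPow t '' G) := by
    refine add_mem hfG ?_
    rw [hsqG]
    exact Ideal.sum_mem _ fun c hc => Ideal.mul_mem_left _ _ (uPow_mem_span_uPow t (Finset.mem_filter.mp hc).2)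
  refine ⟨q', r, hmemG, ?_, by rw [hsq]; ring⟩
  rw [hsq, ← add_assoc]
  -- `u r²` lies in `Good + R`
  have hD : uPow t ε * r ^ 2 ∈ Ideal.span (uPow t '' (G ∪ R)) := by
    have : uPow t ε * r ^ 2 = (f + uPow t ε * q' ^ 2) - (f + uPow t ε * q ^ 2) := by rw [hsq]; ring
    rw [this, Set.image_union, Ideal.span_union]
    exact sub_mem (Ideal.mem_sup_left hmemG) (Ideal.mem_sup_right hB)
  -- every term of `u r²` lies in `R`
  rw [hsqR] at hD ⊢
  refine add_mem hB (Ideal.sum_mem _ fun c hc => Ideal.mul_mem_left _ _ (uPow_mem_span_uPow t ?_))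
  obtain ⟨c₀, hc₀c, hc₀min⟩ := (QR.filter (fun c' => c' ≤ c)).exists_le_minimal (Finset.mem_filter.mpr ⟨hc, le_rfl⟩)
  obtain ⟨hc₀R, hc₀le⟩ := Finset.mem_filter.mp hc₀min.prop
  have hηR : ∀ c ∈ QR, η c ∉ Ideal.span (Set.range t) := fun c hc => hηu c (Finset.mem_filter.mp hc).1
  have hmin0 : 2 • c₀ + ε ∈ minExponents t (∑ c ∈ QR, η c ^ 2 * uPow t (2 • c + ε)) := by
    refine two_nsmul_add_mem_minExponents_sum_sq ht QR hηR ε hc₀R fun c' hc' hle => ?_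
    exact hc₀min.eq_of_le (Finset.mem_filter.mpr ⟨hc', hle.trans hc₀le⟩) hle
  obtain ⟨g, hg, hgle⟩ := exists_le_of_mem_span_uPow ht hD hmin0
  have hle : 2 • c₀ + ε ≤ 2 • c + ε := fun l => by
    have h : c₀ l ≤ c l := hc₀le l
    show (2 • c₀ + ε) l ≤ (2 • c + ε) l
    simp only [Pi.add_apply, Pi.smul_apply, smul_eq_mul]; omega
  rcases hg with hg | hg
  · exact absurd (hG _ _ hgle hg) (Finset.mem_filter.mp hc₀R).2
  · exact hR _ _ (hgle.trans hle) hg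

/-! ## §4 The twisted `δ*` along the orbit -/

/-- `DeltaStarGeTw` is an orbit invariant. [folklore] -/
theorem deltaStarGeTw_iff_of_isGaugeRepTw [CharP S 2] {u x y z w f z' w' f' : S} (h : IsGaugeRepTw u x y z w f z' w' f')
    (d : ℕ) (ρ : ℚ) : DeltaStarGeTw u x y z' w' d ρ f' ↔ DeltaStarGeTw u x y z w d ρ f := by
  constructor
  · rintro ⟨z₂, w₂, f₂, h₂, hδ⟩
    exact ⟨z₂, w₂, f₂, isGaugeRepTw_trans h h₂, hδ⟩
  · rintro ⟨z₂, w₂, f₂, h₂, hδ⟩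
    exact ⟨z₂, w₂, f₂, isGaugeRepTw_trans (isGaugeRepTw_symm h) h₂, hδ⟩

/-- `IsDeltaStarTw` is an orbit invariant. [folklore] -/
theorem isDeltaStarTw_iff_of_isGaugeRepTw [CharP S 2] {u x y z w f z' w' f' : S} (h : IsGaugeRepTw u x y z w f z' w' f')
    (d : ℕ) (δ : ℚ) : IsDeltaStarTw u x y z' w' d δ f' ↔ IsDeltaStarTw u x y z w d δ f := by
  unfold IsDeltaStarTw
  simp only [deltaStarGeTw_iff_of_isGaugeRepTw h]

/-- `δ*` is unique. [folklore] -/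
theorem isDeltaStarTw_unique {u x y z w : S} {d : ℕ} {δ δ' : ℚ} {f : S} (h : IsDeltaStarTw u x y z w d δ f)
    (h' : IsDeltaStarTw u x y z w d δ' f) : δ' = δ :=
  le_antisymm (h.2 _ h'.1) (h'.2 _ h.1)

end Summit.ResolutionOfSingularities.ResolutionOfSingularities.Theorems.SwitchingDichotomy.BetaNewton

end
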